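import Literature.Computability.Complexity.TodaWitnessLanguage
import Literature.Computability.Complexity.ThresholdPP
import Literature.Computability.Complexity.ModulusAmplification
import Literature.Computability.Complexity.ProbabilisticClassesProofs
import HarnessLib

/-!
# The witness language of Toda's amplified count counts `Σ_y A±_ℓ(#W(x, y))` (second half of Toda's theorem: the count)

Topic `Computability/Complexity` (counting classes), sibling of `TodaWitnessLanguage.lean` (the
language `todaLang W p q ∈ P` and its semantics `mem_todaLang_iff`) and `ModulusAmplification.lean`
(`ModAmp.Apos`, `ModAmp.Aneg`: the two halves of the explicit Toda/Beigel–Tarui amplifying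
polynomial, `amplify_modEq`, `sum_amplified_modEq`). Arora–Barak 2009, proof of Thm. 17.14 from
Lemma 17.22 (p. 423); Toda 1991, §4. Main result:

* **`count_todaLang`**: for every `x` and side `b`,
  `#todaLang(⟨x, [b]⟩)` (witness length `LwP`) `= Σ_{y ∈ {0,1}^m} A^{b}_ℓ(#W(x, y))`, where
  `A^{1} = ModAmp.Apos ℓ`, `A^{0} = ModAmp.Aneg ℓ`, `ℓ = m + 1`, `m = p(|x|)`, and
  `#W(x, y) = cW = #{v ∈ {0,1}^w | ⟨⟨x, y⟩, v⟩ ∈ W}`, `w = q(2|x| + 2 + m)`.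

The proof peels the witness `u = y · mode · s₁ · B₁ · s₂ · B₂` field by field (`cnt_add`,
`cnt_succ`, `cnt_take_drop` of `ProbabilisticClassesProofs.lean`): the mode-`1` strings contribute `[b = 1]` per `y`
(`count_eq_sum_C0`); a block group with flags `s` contributes `#W(x,y)^{|s|₁}` (`cnt_blocks_window`,
`cnt_group`); summing over `s₁` by popcount gives `Σ_{i ≡ b} C(ℓ, i) c^i` (`sum_s1`,
`cnt_count_eq_choose`), over the valid `s₂` gives `Σ_{j ≤ m} C(m+j, j) c^j` (`sum_s2`, `cnt_spread`:
the strings of length `2m` with `j` ones all before position `m + j`), and the product of the two is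
the double sum of `ModAmp.Apos`/`Aneg` (`filter_sum_mul_sum`).

Generic lemmas of independent interest: `cnt_add` (splitting a count at a prefix length),
`cnt_add_indep`, `cnt_blocks_window`, `sum_vector_by_count`, `cnt_count_eq_choose`, `prod_ite_getD`,
`true_notMem_iff_getD`, `spread_iff`.

## References

* S. Arora, B. Barak, *Computational Complexity: A Modern Approach*, CUP 2009, Lemma 17.22 and
  the proof of Thm. 17.14 (p. 423).
* S. Toda, *PP is as hard as the polynomial-time hierarchy*, SIAM J. Comput. 20 (1991), §4.
* R. Beigel, J. Tarui, *On ACC*, Comput. Complexity 4 (1994) (modulus amplifying polynomials).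
-/

namespace Literature.Computability.Complexity

open _root_.Computability Polynomial UnaryOffsets Finset

namespace TodaCount

/-! ### Generic counting lemmas on coin strings -/

/-- **Splitting a count at a prefix length**: the strings of length `a + b` in `E`, counted by
their prefix of length `a`. Twin of `QuantumComplexity.ADH.cnt_add_eq_sum` (`ADHPathModel.lean`,
cross-topic; the import would run the wrong way) — both are candidates for a hoist into
`CoinCounting.lean`. [folklore] -/
theorem cnt_add : ∀ (a b : ℕ) (E : Set (List Bool)),
    cnt (a + b) E = ∑ v : List.Vector Bool a, cnt b {w | v.toList ++ w ∈ E}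
  | 0, b, E => by
    rw [Finset.sum_congr rfl fun (v : List.Vector Bool 0) _ =>
      show cnt b {w | v.toList ++ w ∈ E} = cnt b E by rw [List.Vector.eq_nil v]; rfl,
      sum_const, card_univ, card_vector, pow_zero, one_smul, Nat.zero_add]
  | a + 1, b, E => by
    classical
    rw [show a + 1 + b = (a + b) + 1 by omega, cnt_succ, cnt_add a b, cnt_add a b]
    let e : Bool × List.Vector Bool a ≃ List.Vector Bool (a + 1) :=
      { toFun := fun p => p.1 ::ᵥ p.2
        invFun := fun v => (v.head, v.tail)
        left_inv := fun p => by simp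
        right_inv := fun v => List.Vector.cons_head_tail v }
    rw [← Fintype.sum_equiv e _ (fun u => cnt b {w | u.toList ++ w ∈ E}) (fun _ => rfl), Fintype.sum_prod_type,
      Fintype.sum_bool, add_comm]
    rfl

/-- A window inside a prefix of known length. [folklore] -/
theorem window_append_lt {v : List Bool} {a : ℕ} (hv : v.length = a) (w : List Bool) {o L : ℕ} (h : o + L ≤ a) :
    window (v ++ w) o L = window v o L := by
  rw [window_eq_ofFn, window_eq_ofFn]
  congr 1; funext c
  rw [List.getD_append _ _ _ _ (by omega)]

/-- The prefix of known length as a window. [folklore] -/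
theorem window_append_zero {v : List Bool} {a : ℕ} (hv : v.length = a) (w : List Bool) : window (v ++ w) 0 a = v := by
  subst hv
  rw [window_eq_take_drop (by simp), List.drop_zero, List.take_left']
  rfl

/-- A window past a prefix of known length. [folklore] -/
theorem window_append_ge {v : List Bool} {a : ℕ} (hv : v.length = a) (w : List Bool) {o : ℕ} (ho : a ≤ o) (L : ℕ) :
    window (v ++ w) o L = window w (o - a) L := by
  obtain ⟨d, rfl⟩ := Nat.exists_eq_add_of_le ho
  rw [Nat.add_sub_cancel_left, ← hv, window_append_length_add]

/-- Dropping past a prefix of known length. [folklore] -/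
theorem drop_append_ge {v : List Bool} {a : ℕ} (hv : v.length = a) (w : List Bool) {o : ℕ} (ho : a ≤ o) :
    (v ++ w).drop o = w.drop (o - a) := by
  rw [List.drop_append, List.drop_of_length_le (by omega), List.nil_append, hv]

/-- **Counting block tuples** (window form): strings of `k` blocks of length `w`, block `i`
constrained to `good i`, number `∏_{i<k} cnt w (good i)`. The `(y.drop (i*B)).take B` form is the
tree's `Literature.Computability.Complexity.cnt_blocks` (`IsolationAdvice.lean`, not imported here: its
closure carries the Stockmeyer/Valiant–Vazirani files); by `window_eq_take_drop` the two agree on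
strings of the full length. [folklore] -/
theorem cnt_blocks_window (w : ℕ) (good : ℕ → Set (List Bool)) :
    ∀ k : ℕ, cnt (k * w) {B | ∀ i < k, window B (i * w) w ∈ good i} = ∏ i ∈ range k, cnt w (good i)
  | 0 => by
    rw [prod_range_zero, Nat.zero_mul]
    exact cnt_eq_two_pow_of_forall (m := 0) (fun y _ => by simp) |>.trans (pow_zero 2)
  | k + 1 => by
    classical
    rw [Nat.succ_mul, Nat.add_comm, cnt_add, prod_range_succ']
    have ih := cnt_blocks_window w (fun i => good (i + 1)) k
    have hsplit : ∀ v : List.Vector Bool w,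
        cnt (k * w) {B | v.toList ++ B ∈ {B : List Bool | ∀ i < k + 1, window B (i * w) w ∈ good i}} =
          if v.toList ∈ good 0 then cnt (k * w) {B | ∀ i < k, window B (i * w) w ∈ good (i + 1)} else 0 := by
      intro v
      have hv : v.toList.length = w := by simp
      have hE : {B : List Bool | v.toList ++ B ∈ {B : List Bool | ∀ i < k + 1, window B (i * w) w ∈ good i}} =
          {B | v.toList ∈ good 0 ∧ ∀ i < k, window B (i * w) w ∈ good (i + 1)} := by
        ext B
        simp only [Set.mem_setOf_eq]
        constructor
        · intro H
          refine ⟨?_, fun i hi => ?_⟩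
          · have := H 0 (by omega)
            rwa [Nat.zero_mul, window_append_zero hv] at this
          · have := H (i + 1) (by omega)
            rwa [window_append_ge hv _ (by rw [Nat.succ_mul]; omega), Nat.succ_mul, Nat.add_sub_cancel] at this
        · rintro ⟨h0, H⟩ i hi
          rcases i with _ | i
          · rw [Nat.zero_mul, window_append_zero hv]; exact h0
          · rw [window_append_ge hv _ (by rw [Nat.succ_mul]; omega), Nat.succ_mul, Nat.add_sub_cancel]
            exact H i (by omega)
      rw [hE]
      split_ifs with h0
      · exact cnt_congr fun B _ => by simp [h0]
      · have : {B : List Bool | v.toList ∈ good 0 ∧ ∀ i < k, window B (i * w) w ∈ good (i + 1)} = ∅ :=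
          Set.eq_empty_of_forall_notMem fun B hB => h0 hB.1
        rw [this]; unfold cnt; simp
    simp only [hsplit]
    rw [Finset.sum_ite, sum_const_zero, add_zero, sum_const, smul_eq_mul, ih, mul_comm]
    congr 1

/-! ### Popcounts -/

/-- **Summing a function of the popcount over all strings of a length**, fibrewise.
[folklore] -/
theorem sum_vector_by_count (L : ℕ) (F : ℕ → ℕ) :
    ∑ v : List.Vector Bool L, F (v.toList.count true) = ∑ i ∈ range (L + 1), cnt L {s | s.count true = i} * F i := by
  classical
  rw [← sum_fiberwise_of_maps_to (s := (univ : Finset (List.Vector Bool L))) (t := range (L + 1))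
    (g := fun v : List.Vector Bool L => v.toList.count true)
    (fun v _ => mem_range.2 (Nat.lt_succ_of_le ((List.count_le_length).trans_eq (by simp))))]
  refine sum_congr rfl fun i _ => ?_
  rw [sum_congr rfl fun v (hv : v ∈ univ.filter fun v : List.Vector Bool L => v.toList.count true = i) =>
    show F (v.toList.count true) = F i by rw [(mem_filter.1 hv).2], sum_const, smul_eq_mul]
  congr 1
  unfold cnt
  congr 1
  ext v
  simp

/-- **Strings of length `L` with `i` ones number `C(L, i)`** (Pascal's rule via `cnt_succ`).
[folklore] -/
theorem cnt_count_eq_choose : ∀ L i : ℕ, cnt L {s | s.count true = i} = L.choose i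
  | 0, i => by
    classical
    rw [cnt_zero]
    cases i <;> simp
  | L + 1, i => by
    rw [cnt_succ]
    have h0 : {y : List Bool | false :: y ∈ {s : List Bool | s.count true = i}} = {s | s.count true = i} := by
      ext y; simp
    rw [h0, cnt_count_eq_choose L i]
    rcases i with _ | i
    · have h1 : {y : List Bool | true :: y ∈ {s : List Bool | s.count true = 0}} = ∅ := by
        ext y; simp
      rw [h1]; unfold cnt; simp
    · have h1 : {y : List Bool | true :: y ∈ {s : List Bool | s.count true = i + 1}} = {s | s.count true = i} := by
        ext y; simp
      rw [h1, cnt_count_eq_choose L i, Nat.choose_succ_succ, add_comm]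

/-- **A product of per-position factors is a power of the popcount**:
`∏_{i<|s|} (if s[i] then c else 1) = c^{|s|₁}`. [folklore] -/
theorem prod_ite_getD (c : ℕ) : ∀ s : List Bool,
    ∏ i ∈ range s.length, (if s.getD i false = true then c else 1) = c ^ s.count true
  | [] => by simp
  | b :: s => by
    rw [List.length_cons, prod_range_succ']
    simp only [List.getD_cons_succ, List.getD_cons_zero]
    rw [prod_ite_getD c s]
    cases b <;> simp [pow_succ]

/-- No `1` at all, read through `getD`. [folklore] -/
theorem true_notMem_iff_getD (l : List Bool) : true ∉ l ↔ ∀ i, l.getD i false = false := by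
  constructor
  · intro h i
    by_contra hne
    have hget : l.getD i false = true := by cases h' : l.getD i false <;> simp_all
    have hlt : i < l.length := by
      by_contra hge
      rw [List.getD_eq_default _ _ (by omega)] at hget
      exact Bool.false_ne_true hget
    rw [List.getD_eq_getElem _ _ hlt] at hget
    exact h (hget ▸ List.getElem_mem hlt)
  · intro h hmem
    obtain ⟨i, hi, hget⟩ := List.mem_iff_getElem.1 hmem
    have := h i
    rw [List.getD_eq_getElem _ _ hi, hget] at this
    exact Bool.noConfusion this

/-- No `1` from position `k` on, read through `getD`. [folklore] -/
theorem true_notMem_drop_iff (s : List Bool) (k : ℕ) : true ∉ s.drop k ↔ ∀ e, k ≤ e → s.getD e false = false := by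
  rw [true_notMem_iff_getD]
  constructor
  · intro h e he
    have := h (e - k)
    rwa [List.getD_eq_getElem?_getD, List.getElem?_drop, show k + (e - k) = e by omega, ← List.getD_eq_getElem?_getD] at this
  · intro h i
    rw [List.getD_eq_getElem?_getD, List.getElem?_drop, ← List.getD_eq_getElem?_getD]
    exact h (k + i) (by omega)

/-- **The spread condition of `s₂`** in the machine's form (`e + 2 − (m+1) ≤ |s₂|₁` for every `1`
at position `e < 2m`) says, for a string of length `2m`, that `s₂` has no `1` from position
`m + |s₂|₁` on. [folklore] -/
theorem spread_iff {s : List Bool} {m : ℕ} (hs : s.length = 2 * m) :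
    (∀ e < 2 * m, s.getD e false = true → e + 2 - (m + 1) ≤ s.count true) ↔ true ∉ s.drop (m + s.count true) := by
  rw [true_notMem_drop_iff]
  constructor
  · intro H e he
    by_cases hlt : e < 2 * m
    · by_contra hne
      have hget : s.getD e false = true := by cases h' : s.getD e false <;> simp_all
      have := H e hlt hget
      omega
    · exact List.getD_eq_default _ _ (by omega)
  · intro H e he hget
    by_contra hlt
    have := H e (by omega)
    rw [this] at hget
    exact Bool.false_ne_true hget

/-- **Strings of length `2m` with `j ≤ m` ones, all before position `m + j`, number `C(m+j, j)`**
(the coefficient of `T_ℓ`, `ℓ = m + 1`). [cite: AroraBarak2009, Lemma 17.22] -/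
theorem cnt_spread (m j : ℕ) (hj : j ≤ m) :
    cnt (2 * m) {s | s.count true = j ∧ true ∉ s.drop (m + j)} = (m + j).choose j := by
  have h := ThresholdPP.cnt_take_mem_of_drop_zero {t : List Bool | t.count true = j} (k := m + j) (B := 2 * m) (by omega)
  rw [cnt_count_eq_choose] at h
  rw [← h]
  refine cnt_congr fun s hs => ?_
  simp only [Set.mem_setOf_eq]
  rw [← List.length_drop, ← ThresholdPP.true_not_mem_iff]
  have hsplit : s.count true = (s.take (m + j)).count true + (s.drop (m + j)).count true := by
    rw [← List.count_append, List.take_append_drop]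
  constructor
  · rintro ⟨hc, hz⟩
    have hz' : (s.drop (m + j)).count true = 0 := List.count_eq_zero.2 hz
    exact ⟨by omega, hz⟩
  · rintro ⟨hc, hz⟩
    have hz' : (s.drop (m + j)).count true = 0 := List.count_eq_zero.2 hz
    exact ⟨by omega, hz⟩


/-! ### The count of `todaLang` -/

section Count

variable (W : Language Bool) (p q : Polynomial ℕ) (x : List Bool)

local notation "𝔪" => Polynomial.eval (List.length x) p
local notation "𝔩" => Polynomial.eval (List.length x) p + 1
local notation "𝔴" => Polynomial.eval (List.length x) (wP p q)

/-- The `⊕`-count of `⟨x, y⟩`: `#{v ∈ {0,1}^w | ⟨⟨x, y⟩, v⟩ ∈ W}`. [folklore] -/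
noncomputable def cW (y : List Bool) : ℕ := cnt 𝔴 {v | boolPair (boolPair x y) v ∈ W}

variable {W p q x}

/-- **`cW` is the `⊕`-witness count of `⟨x, y⟩` at the witness length of the parity language**:
for `|y| = m`, `cW W p q x y = countWitnesses W (q |⟨x, y⟩|) ⟨x, y⟩` (`|⟨x, y⟩| = 2|x| + 2 + m`).
[folklore] -/
theorem cW_eq_countWitnesses {y : List Bool} (hy : y.length = 𝔪) :
    cW W p q x y = countWitnesses W (q.eval (boolPair x y).length) (boolPair x y) := by
  rw [cW, eval_wP, length_boolPair, hy]; rfl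

/-- The factor contributed by one block: `#W(x, y)` if the flag is set, `1` otherwise. [folklore] -/
theorem cnt_block (y : List Bool) (fl : Bool) :
    cnt 𝔴 {blk | (fl = true → boolPair (boolPair x y) blk ∈ W) ∧ (fl = false → true ∉ blk)} =
      if fl = true then cW W p q x y else 1 := by
  cases fl
  · simp only [Bool.false_eq_true, IsEmpty.forall_iff, true_and, forall_true_left, if_false]
    exact PPSharpP.cnt_noTrue _
  · simp only [forall_true_left, Bool.true_eq_false, IsEmpty.forall_iff, and_true, if_true]
    rfl

/-- **A block group contributes `#W(x,y)^{|flags|₁}`**: the strings of `k = |s|` blocks, block `i` a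
`W`-witness of `⟨x, y⟩` if `s[i] = 1` and all-zero otherwise. [cite: AroraBarak2009, Thm. 17.14 (proof)] -/
theorem cnt_group (y s : List Bool) :
    cnt (s.length * 𝔴) {B | ∀ i < s.length, (s.getD i false = true → boolPair (boolPair x y) (window B (i * 𝔴) 𝔴) ∈ W) ∧
      (s.getD i false = false → true ∉ window B (i * 𝔴) 𝔴)} = cW W p q x y ^ s.count true := by
  have h := cnt_blocks_window 𝔴 (fun i => {blk | (s.getD i false = true → boolPair (boolPair x y) blk ∈ W) ∧
      (s.getD i false = false → true ∉ blk)}) s.length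
  simp only [Set.mem_setOf_eq] at h
  rw [h, ← prod_ite_getD]
  exact prod_congr rfl fun i _ => cnt_block y _

/-- **The `s₁`-sum**: `Σ_{s₁ ∈ {0,1}^ℓ, |s₁|₁ ≡ side} c^{|s₁|₁} = Σ_{i ≤ ℓ, i ≡ side} C(ℓ, i) c^i`.
[cite: AroraBarak2009, Lemma 17.22] -/
theorem sum_s1 (L c : ℕ) (side : Prop) [Decidable side] :
    ∑ s : List.Vector Bool L, (if (Odd (s.toList.count true) ↔ side) then c ^ s.toList.count true else 0) =
      ∑ i ∈ range (L + 1), if (Odd i ↔ side) then L.choose i * c ^ i else 0 := by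
  rw [sum_vector_by_count L (fun i => if (Odd i ↔ side) then c ^ i else 0)]
  refine sum_congr rfl fun i _ => ?_
  rw [cnt_count_eq_choose]
  split_ifs <;> simp

/-- **The `s₂`-sum**: `Σ_{s₂ ∈ {0,1}^{2m} valid} c^{|s₂|₁} = Σ_{j ≤ m} C(m+j, j) c^j`.
[cite: AroraBarak2009, Lemma 17.22] -/
theorem sum_s2 (m c : ℕ) :
    ∑ s : List.Vector Bool (2 * m), (if (¬ (m + 1 ≤ s.toList.count true) ∧
        ∀ e < 2 * m, s.toList.getD e false = true → e + 2 - (m + 1) ≤ s.toList.count true)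
        then c ^ s.toList.count true else 0) =
      ∑ j ∈ range (m + 1), (m + j).choose j * c ^ j := by
  classical
  -- fibrewise over the popcount `j`
  rw [← sum_fiberwise_of_maps_to (s := (univ : Finset (List.Vector Bool (2 * m)))) (t := range (2 * m + 1))
    (g := fun v : List.Vector Bool (2 * m) => v.toList.count true)
    (fun v _ => mem_range.2 (Nat.lt_succ_of_le ((List.count_le_length).trans_eq (by simp))))]
  have hfib : ∀ j ∈ range (2 * m + 1),
      ∑ v ∈ univ.filter (fun v : List.Vector Bool (2 * m) => v.toList.count true = j),
        (if (¬ (m + 1 ≤ v.toList.count true) ∧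
          ∀ e < 2 * m, v.toList.getD e false = true → e + 2 - (m + 1) ≤ v.toList.count true)
          then c ^ v.toList.count true else 0) =
        if j ≤ m then (m + j).choose j * c ^ j else 0 := by
    intro j _
    split_ifs with hjm
    · -- inside the fibre the summand is `[valid] · c^j`
      rw [sum_congr rfl fun v (hv : v ∈ univ.filter fun v : List.Vector Bool (2 * m) => v.toList.count true = j) =>
        show (if (¬ (m + 1 ≤ v.toList.count true) ∧
            ∀ e < 2 * m, v.toList.getD e false = true → e + 2 - (m + 1) ≤ v.toList.count true)
            then c ^ v.toList.count true else 0) =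
          if true ∉ v.toList.drop (m + j) then c ^ j else 0 by
            have hc : v.toList.count true = j := (mem_filter.1 hv).2
            have hiff := spread_iff (s := v.toList) (m := m) (by simp)
            by_cases hz : true ∉ v.toList.drop (m + j)
            · rw [if_pos hz, if_pos ⟨by omega, hiff.2 (hc ▸ hz)⟩, hc]
            · rw [if_neg hz, if_neg (fun h => hz (hc ▸ hiff.1 h.2))]]
      rw [sum_ite, sum_const_zero, add_zero, sum_const, smul_eq_mul, ← cnt_spread m j hjm]
      congr 1
      unfold cnt
      rw [filter_filter]
      refine card_equiv (Equiv.refl _) fun v => ?_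
      simp only [Equiv.refl_apply, mem_filter, mem_univ, true_and, Set.mem_setOf_eq]
    · apply sum_eq_zero
      intro v hv
      rw [mem_filter] at hv
      rw [if_neg]
      rintro ⟨hle, -⟩
      rw [hv.2] at hle
      omega
  rw [sum_congr rfl hfib, sum_ite, sum_const_zero, add_zero]
  refine sum_congr ?_ fun j _ => rfl
  ext j; simp only [mem_filter, mem_range]; omega

end Count

/-! ### The peeling computation -/

/-- A window of a suffix. [folklore] -/
theorem window_drop (s : List Bool) (k o L : ℕ) : window (s.drop k) o L = window s (k + o) L := by
  rw [window, window, List.drop_drop]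

section Main

variable (W : Language Bool) (p q : Polynomial ℕ) (x : List Bool) (b : Bool)

local notation "𝔪" => Polynomial.eval (List.length x) p
local notation "𝔩" => Polynomial.eval (List.length x) p + 1
local notation "𝔴" => Polynomial.eval (List.length x) (wP p q)

/-- Block group one, generic in the field values. [folklore] -/
def G1 (y s1 : List Bool) (blk : ℕ → List Bool) : Prop :=
  ∀ i < 𝔩, (s1.getD i false = true → boolPair (boolPair x y) (blk i) ∈ W) ∧ (s1.getD i false = false → true ∉ blk i)

/-- Block group two with the spread condition, generic in the field values. [folklore] -/
def G2 (y s2 : List Bool) (blk : ℕ → List Bool) : Prop :=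
  ∀ e < 2 * 𝔪, ((s2.getD e false = true → boolPair (boolPair x y) (blk e) ∈ W) ∧
    (s2.getD e false = false → true ∉ blk e)) ∧ (s2.getD e false = true → e + 2 - 𝔩 ≤ s2.count true)

/-- The mode-`0` condition, generic in the field values. [folklore] -/
def Mode0 (y s1 s2 : List Bool) (blk1 blk2 : ℕ → List Bool) : Prop :=
  (Odd (s1.count true) ↔ b = true) ∧ G1 W p x y s1 blk1 ∧ ¬ (𝔩 ≤ s2.count true) ∧ G2 W p x y s2 blk2

variable {W p q x b}

/-- The side of the tag `[b]`. [folklore] -/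
@[simp] theorem sideB_singleton : sideB [b] ↔ b = true := by simp [sideB]

/-- Step 0: the semantics in generic form. [folklore] -/
theorem spec_iff (u : List Bool) :
    frame x [b] u ∈ todaLang W p q ↔
      ((u.drop 𝔪).head? = some true ∧ b = true ∧ true ∉ u.drop (𝔪 + 1)) ∨
      ((u.drop 𝔪).head? = some false ∧
        Mode0 W p x b (yOf (p := p) x u) (s1Of (p := p) x u) (s2Of (p := p) (q := q) x u)
          (blk1Of (p := p) (q := q) x u) (blk2Of (p := p) (q := q) x u)) := by
  rw [mem_todaLang_iff, sideB_singleton]; rfl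

/-- `Lw = m + (R₂ + 1)` with `R₂ = ℓ + (ℓw + (2m + 2mw))`. [folklore] -/
theorem eval_LwP_eq : (LwP p q).eval x.length = 𝔪 + ((𝔩 + (𝔩 * 𝔴 + (2 * 𝔪 + 2 * 𝔪 * 𝔴))) + 1) := by
  simp only [eval_LwP, eval_oB2, eval_oS2]; ring

/-- `oS2 = m + (1 + (ℓ + ℓ·w))`. [folklore] -/
theorem eval_oS2_eq : (oS2 p q).eval x.length = 𝔪 + (1 + (𝔩 + 𝔩 * 𝔴)) := by
  simp only [eval_oS2]; ring

/-- `oB2 = m + (1 + (ℓ + (ℓ·w + 2m)))`. [folklore] -/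
theorem eval_oB2_eq : (oB2 p q).eval x.length = 𝔪 + (1 + (𝔩 + (𝔩 * 𝔴 + 2 * 𝔪))) := by
  simp only [eval_oB2, eval_oS2]; ring

variable (W p q x b) in
/-- The count after peeling `y` and the mode bit `0`: the mode-`0` strings `r` of length
`ℓ + (ℓw + (2m + 2mw))` (fields at `r`-relative offsets). [folklore] -/
noncomputable def C0 (y : List Bool) : ℕ :=
  cnt (𝔩 + (𝔩 * 𝔴 + (2 * 𝔪 + 2 * 𝔪 * 𝔴)))
    {r | Mode0 W p x b y (window r 0 𝔩) (window r (𝔩 + 𝔩 * 𝔴) (2 * 𝔪)) (fun i => window r (𝔩 + i * 𝔴) 𝔴)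
      (fun e => window r (𝔩 + (𝔩 * 𝔴 + 2 * 𝔪) + e * 𝔴) 𝔴)}

/-- **Fields of `u = y ++ c :: r`** (`|y| = m`): mode bit `c`, rest `r`, `y`, and the windows at
`r`-relative offsets. [folklore] -/
theorem fields_append_cons {y : List Bool} (hy : y.length = 𝔪) (c : Bool) (r : List Bool) :
    (y ++ c :: r).drop 𝔪 = c :: r ∧ (y ++ c :: r).drop (𝔪 + 1) = r ∧
      yOf (p := p) x (y ++ c :: r) = y ∧ s1Of (p := p) x (y ++ c :: r) = window r 0 𝔩 ∧
      s2Of (p := p) (q := q) x (y ++ c :: r) = window r (𝔩 + 𝔩 * 𝔴) (2 * 𝔪) ∧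
      (blk1Of (p := p) (q := q) x (y ++ c :: r) = fun i => window r (𝔩 + i * 𝔴) 𝔴) ∧
      (blk2Of (p := p) (q := q) x (y ++ c :: r) = fun e => window r (𝔩 + (𝔩 * 𝔴 + 2 * 𝔪) + e * 𝔴) 𝔴) := by
  refine ⟨?_, ?_, ?_, ?_, ?_, ?_, ?_⟩
  · rw [drop_append_ge hy _ le_rfl, Nat.sub_self, List.drop_zero]
  · rw [drop_append_ge hy _ (Nat.le_succ _), Nat.succ_sub (le_refl _), Nat.sub_self, List.drop_one, List.tail_cons]
  · exact window_append_zero hy _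
  · rw [s1Of, window_append_ge hy _ (Nat.le_succ _), Nat.succ_sub (le_refl _), Nat.sub_self, window_cons_one]
  · rw [s2Of, eval_oS2_eq, window_append_ge hy _ (Nat.le_add_right _ _), Nat.add_sub_cancel_left, window_cons_one_add]
  · funext i
    rw [blk1Of, show 2 * 𝔪 + 2 + i * 𝔴 = 𝔪 + (1 + (𝔩 + i * 𝔴)) by ring, window_append_ge hy _ (Nat.le_add_right _ _),
      Nat.add_sub_cancel_left, window_cons_one_add]
  · funext e
    rw [blk2Of, eval_oB2_eq, show 𝔪 + (1 + (𝔩 + (𝔩 * 𝔴 + 2 * 𝔪))) + e * 𝔴 = 𝔪 + (1 + (𝔩 + (𝔩 * 𝔴 + 2 * 𝔪) + e * 𝔴)) by ring,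
      window_append_ge hy _ (Nat.le_add_right _ _), Nat.add_sub_cancel_left, window_cons_one_add]

/-- **Peeling `y` and the mode bit.** [cite: AroraBarak2009, Thm. 17.14 (proof)] -/
theorem count_eq_sum_C0 :
    countWitnesses (todaLang W p q) ((LwP p q).eval x.length) (boolPair x [b]) =
      ∑ y : List.Vector Bool 𝔪, ((if b = true then 1 else 0) + C0 W p q x b y.toList) := by
  change cnt ((LwP p q).eval x.length) {u | frame x [b] u ∈ todaLang W p q} = _
  rw [eval_LwP_eq, cnt_add]
  refine sum_congr rfl fun y _ => ?_
  have hy : y.toList.length = 𝔪 := by simp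
  rw [cnt_succ, add_comm]
  congr 1
  · -- mode `1`: the constant term
    have hE : {r : List Bool | true :: r ∈ {w : List Bool | y.toList ++ w ∈ {u : List Bool | frame x [b] u ∈ todaLang W p q}}} =
        {r | b = true ∧ true ∉ r} := by
      ext r
      obtain ⟨h1, h2, -, -, -, -, -⟩ := fields_append_cons (p := p) (q := q) (x := x) hy true r
      simp only [Set.mem_setOf_eq, spec_iff, h1, h2, List.head?_cons, Option.some.injEq, true_and, Bool.true_eq_false,
        false_and, or_false]
    rw [hE]
    cases b
    · have : {r : List Bool | false = true ∧ true ∉ r} = ∅ := Set.eq_empty_of_forall_notMem fun r h => by simp at h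
      rw [this]; unfold cnt; simp
    · simp only [true_and, if_true]
      exact PPSharpP.cnt_noTrue _
  · -- mode `0`
    rw [C0]
    refine cnt_congr fun r _ => ?_
    obtain ⟨h1, -, h3, h4, h5, h6, h7⟩ := fields_append_cons (p := p) (q := q) (x := x) hy false r
    simp only [Set.mem_setOf_eq, spec_iff, h1, h3, h4, h5, h6, h7, List.head?_cons, Option.some.injEq,
      Bool.false_eq_true, false_and, false_or, true_and]


/-- `G1` only looks at the blocks below `ℓ`. [folklore] -/
theorem G1_congr {y s1 : List Bool} {blk blk' : ℕ → List Bool} (h : ∀ i < 𝔩, blk i = blk' i) :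
    G1 W p x y s1 blk ↔ G1 W p x y s1 blk' := by
  unfold G1
  exact forall₂_congr fun i hi => by rw [h i hi]

variable (W p q x) in
/-- The `s₂`-side count for given `y`: `Σ_{s₂ valid} #W(x,y)^{|s₂|₁}`. [folklore] -/
noncomputable def S2 (y : List Bool) : ℕ :=
  ∑ s : List.Vector Bool (2 * 𝔪), (if (¬ (𝔪 + 1 ≤ s.toList.count true) ∧
      ∀ e < 2 * 𝔪, s.toList.getD e false = true → e + 2 - (𝔪 + 1) ≤ s.toList.count true)
      then cW W p q x y ^ s.toList.count true else 0)

/-- **The second group**: for given `y` (and the parity test passed), the strings `s₂ B₂` of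
length `2m + 2mw` satisfying `|s₂|₁ ≤ ℓ − 1` and `G2` number `S2 y`. [cite: AroraBarak2009, Thm. 17.14 (proof)] -/
theorem cnt_Q (y : List Bool) :
    cnt (2 * 𝔪 + 2 * 𝔪 * 𝔴) {r | ¬ (𝔩 ≤ (window r 0 (2 * 𝔪)).count true) ∧
        G2 W p x y (window r 0 (2 * 𝔪)) (fun e => window r (2 * 𝔪 + e * 𝔴) 𝔴)} = S2 W p q x y := by
  rw [cnt_add, S2]
  refine sum_congr rfl fun s _ => ?_
  have hs : s.toList.length = 2 * 𝔪 := by simp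
  have hfields : ∀ B : List Bool, window (s.toList ++ B) 0 (2 * 𝔪) = s.toList ∧
      (fun e => window (s.toList ++ B) (2 * 𝔪 + e * 𝔴) 𝔴) = fun e => window B (e * 𝔴) 𝔴 := fun B =>
    ⟨window_append_zero hs _, funext fun e => by rw [window_append_ge hs _ (Nat.le_add_right _ _), Nat.add_sub_cancel_left]⟩
  have hE : {B : List Bool | s.toList ++ B ∈ {r : List Bool | ¬ (𝔩 ≤ (window r 0 (2 * 𝔪)).count true) ∧
      G2 W p x y (window r 0 (2 * 𝔪)) (fun e => window r (2 * 𝔪 + e * 𝔴) 𝔴)}} =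
      {B | (¬ (𝔩 ≤ s.toList.count true) ∧ ∀ e < 2 * 𝔪, s.toList.getD e false = true → e + 2 - 𝔩 ≤ s.toList.count true) ∧
        ∀ e < 2 * 𝔪, (s.toList.getD e false = true → boolPair (boolPair x y) (window B (e * 𝔴) 𝔴) ∈ W) ∧
          (s.toList.getD e false = false → true ∉ window B (e * 𝔴) 𝔴)} := by
    ext B
    rw [Set.mem_setOf_eq, Set.mem_setOf_eq, Set.mem_setOf_eq, (hfields B).1, (hfields B).2]
    simp only [G2]
    constructor
    · rintro ⟨hpc, H⟩; exact ⟨⟨hpc, fun e he => (H e he).2⟩, fun e he => (H e he).1⟩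
    · rintro ⟨⟨hpc, H2⟩, H1⟩; exact ⟨hpc, fun e he => ⟨H1 e he, H2 e he⟩⟩
  rw [hE]
  have hg := cnt_group (W := W) (p := p) (q := q) (x := x) y s.toList
  rw [hs] at hg
  split_ifs with hvalid
  · rw [← hg]
    refine cnt_congr fun B _ => ?_
    simp only [Set.mem_setOf_eq]
    exact ⟨fun h => h.2, fun h => ⟨hvalid, h⟩⟩
  · have : {B : List Bool | (¬ (𝔩 ≤ s.toList.count true) ∧ ∀ e < 2 * 𝔪, s.toList.getD e false = true →
        e + 2 - 𝔩 ≤ s.toList.count true) ∧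
        ∀ e < 2 * 𝔪, (s.toList.getD e false = true → boolPair (boolPair x y) (window B (e * 𝔴) 𝔴) ∈ W) ∧
          (s.toList.getD e false = false → true ∉ window B (e * 𝔴) 𝔴)} = ∅ :=
      Set.eq_empty_of_forall_notMem fun B hB => hvalid hB.1
    rw [this]; unfold cnt; simp

/-- **Peeling `s₁` and splitting the two groups**: `C0 y = (Σ_{s₁, |s₁|₁ ≡ b} c^{|s₁|₁}) · S2 y`,
`c = #W(x, y)`. [cite: AroraBarak2009, Thm. 17.14 (proof)] -/
theorem C0_eq (y : List Bool) :
    C0 W p q x b y = (∑ s : List.Vector Bool 𝔩, (if (Odd (s.toList.count true) ↔ b = true)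
      then cW W p q x y ^ s.toList.count true else 0)) * S2 W p q x y := by
  rw [C0, cnt_add, sum_mul]
  refine sum_congr rfl fun s _ => ?_
  have hs : s.toList.length = 𝔩 := by simp
  -- the set after `s₁ = s`, as independent conditions on `B₁ = r ↾ ℓw` and the rest `r ⇂ ℓw`
  have hE : {r : List Bool | s.toList ++ r ∈ {r : List Bool | Mode0 W p x b y (window r 0 𝔩) (window r (𝔩 + 𝔩 * 𝔴) (2 * 𝔪))
      (fun i => window r (𝔩 + i * 𝔴) 𝔴) (fun e => window r (𝔩 + (𝔩 * 𝔴 + 2 * 𝔪) + e * 𝔴) 𝔴)}} =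
      {r | r.take (𝔩 * 𝔴) ∈ {B : List Bool | ∀ i < 𝔩,
          (s.toList.getD i false = true → boolPair (boolPair x y) (window B (i * 𝔴) 𝔴) ∈ W) ∧
          (s.toList.getD i false = false → true ∉ window B (i * 𝔴) 𝔴)} ∧
        r.drop (𝔩 * 𝔴) ∈ {r' : List Bool | (Odd (s.toList.count true) ↔ b = true) ∧
          (¬ (𝔩 ≤ (window r' 0 (2 * 𝔪)).count true) ∧
            G2 W p x y (window r' 0 (2 * 𝔪)) (fun e => window r' (2 * 𝔪 + e * 𝔴) 𝔴))}} := by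
    ext r
    have h1 : window (s.toList ++ r) 0 𝔩 = s.toList := window_append_zero hs _
    have h2 : window (s.toList ++ r) (𝔩 + 𝔩 * 𝔴) (2 * 𝔪) = window (r.drop (𝔩 * 𝔴)) 0 (2 * 𝔪) := by
      rw [window_append_ge hs _ (Nat.le_add_right _ _), Nat.add_sub_cancel_left, window_drop]
      rfl
    have h3 : ∀ i < 𝔩, window (s.toList ++ r) (𝔩 + i * 𝔴) 𝔴 = window (r.take (𝔩 * 𝔴)) (i * 𝔴) 𝔴 := fun i hi => by
      rw [window_append_ge hs _ (Nat.le_add_right _ _), Nat.add_sub_cancel_left, window_take]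
      calc i * 𝔴 + 𝔴 = (i + 1) * 𝔴 := by ring
        _ ≤ 𝔩 * 𝔴 := Nat.mul_le_mul_right _ hi
    have h4 : (fun e => window (s.toList ++ r) (𝔩 + (𝔩 * 𝔴 + 2 * 𝔪) + e * 𝔴) 𝔴) =
        fun e => window (r.drop (𝔩 * 𝔴)) (2 * 𝔪 + e * 𝔴) 𝔴 := funext fun e => by
      rw [Nat.add_assoc, window_append_ge hs _ (Nat.le_add_right _ _), Nat.add_sub_cancel_left, window_drop,
        Nat.add_assoc]
    rw [Set.mem_setOf_eq, Set.mem_setOf_eq, Set.mem_setOf_eq, Set.mem_setOf_eq, Set.mem_setOf_eq, h1, h2, h4, Mode0,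
      G1_congr h3]
    unfold G1
    tauto
  have hg := cnt_group (W := W) (p := p) (q := q) (x := x) y s.toList
  rw [hs] at hg
  rw [hE, cnt_take_drop, hg]
  by_cases hpar : (Odd (s.toList.count true) ↔ b = true)
  · rw [if_pos hpar, ← cnt_Q (W := W) (p := p) (q := q) (x := x) y]
    congr 1
    exact cnt_congr fun r _ => by simp only [Set.mem_setOf_eq, hpar, true_and]
  · rw [if_neg hpar, zero_mul]
    have : {r' : List Bool | (Odd (s.toList.count true) ↔ b = true) ∧
        (¬ (𝔩 ≤ (window r' 0 (2 * 𝔪)).count true) ∧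
          G2 W p x y (window r' 0 (2 * 𝔪)) (fun e => window r' (2 * 𝔪 + e * 𝔴) 𝔴))} = ∅ :=
      Set.eq_empty_of_forall_notMem fun r h => hpar h.1
    rw [this]; unfold cnt; simp

/-- Distributing the two coefficient sums (`c^i · c^j = c^{i+j}`). [folklore] -/
theorem filter_sum_mul_sum (L M c : ℕ) (P : ℕ → Prop) [DecidablePred P] :
    (∑ i ∈ range (L + 1), if P i then L.choose i * c ^ i else 0) * (∑ j ∈ range (M + 1), (M + j).choose j * c ^ j) =
      ∑ i ∈ (range (L + 1)).filter P, ∑ j ∈ range (M + 1), L.choose i * (M + j).choose j * c ^ (i + j) := by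
  rw [← sum_filter, sum_mul_sum]
  exact sum_congr rfl fun i _ => sum_congr rfl fun j _ => by ring

/-- **The count of the witness language is the sum of the amplified `⊕`-counts**:
`#todaLang(⟨x, [1]⟩) = Σ_{y ∈ {0,1}^m} A⁺_ℓ(#W(x, y))` and `#todaLang(⟨x, [0]⟩) = Σ_y A⁻_ℓ(#W(x, y))`,
`ℓ = m + 1` (the explicit Toda/Beigel–Tarui polynomial of `ModulusAmplification.lean`, realised by
witnesses: Arora–Barak 2009, proof of Thm. 17.14 from Lemma 17.22). [cite: AroraBarak2009, Thm. 17.14 (proof)] -/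
theorem count_todaLang :
    countWitnesses (todaLang W p q) ((LwP p q).eval x.length) (boolPair x [b]) =
      ∑ y : List.Vector Bool 𝔪, (if b = true then ModAmp.Apos 𝔩 (cW W p q x y.toList)
        else ModAmp.Aneg 𝔩 (cW W p q x y.toList)) := by
  rw [count_eq_sum_C0]
  refine sum_congr rfl fun y _ => ?_
  rw [C0_eq, sum_s1, S2, sum_s2, filter_sum_mul_sum]
  have hodd : ∀ i : ℕ, (Odd i ↔ True) ↔ ¬ 2 ∣ i := fun i => by
    rw [iff_true, ← Nat.not_even_iff_odd, even_iff_two_dvd]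
  have heven : ∀ i : ℕ, (Odd i ↔ False) ↔ 2 ∣ i := fun i => by
    rw [iff_false, Nat.not_odd_iff_even, even_iff_two_dvd]
  cases b
  · simp only [Bool.false_eq_true, if_false, Nat.zero_add, ModAmp.Aneg, Nat.add_sub_cancel]
    refine sum_congr (filter_congr fun i _ => heven i) fun i _ => rfl
  · simp only [if_true, ModAmp.Apos, Nat.add_sub_cancel]
    congr 1
    refine sum_congr (filter_congr fun i _ => hodd i) fun i _ => rfl

end Main

end TodaCount
end Literature.Computability.Complexity
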